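import Mathlib
import Summits.CriticalPhenomena.PercolationContinuityZ3.Theorems.PercNearOneGluingNoHeavyLowerTailHexMSReduction

/-!
# Δ-MS, part 1: the twin configuration (projection and twin bookkeeping for the projective Marica–Schönheim inequality)

Support file for crux `stmt-CriticalPhenomena-4575` (`NoHeavyLowerTail`, route `PercNearOneGluingNoHeavy`), hull-port seat `prim-hp-7`
(generation 66); `--supports stmt-CriticalPhenomena-4575`.  No `sorry`.  Memo: `run/shared/lean/prim/prim-hp-7/FROM-prim-hp-7-g66-DELTA-MS-PROOF.md`.

Set-theoretic bookkeeping for the proof (part 2, `…LowerTailDeltaMS`) of **Δ-MS** (projective Marica–Schönheim: for every family `F` of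
subsets of `U`, `#(F ∪ co F) ≤ #((F \\ F) ∪ co (F \\ F))`, `co Z = {U \ z}`) and of the **twin lemma** it is a special case of: for `C`
arbitrary and `I, J` closed under `U \ ·`, `#IN ≤ #(OUT ∪ co OUT)` with
  `IN  = (C ∪ co C) ∪ (I ∪ J)`                      (written `(C ∪ C.image (U \ ·)) ∪ (I ∪ J)` below),
  `OUT = ((C ∪ J) ⊼ (co C ∪ I)) ∪ (I ∪ J)`.
The proof is an induction on the ground set `insert r U'` along the projection identity `#Z = #(Z.image (erase r)) + #(edgesAt Z r)`
(`…HexMSReduction`).  This file shows (a) that the OUT of the PROJECTED families embeds into the projection of OUT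
(`cl_twinOut_image_subset`, `twinIn_image_subset`), and (b) that the `r`-twins of IN are the IN of an explicit DERIVED configuration one
dimension down — `C₂ = {w ∈ C ∪ I : r ∉ w, insert r w ∈ C ∪ J}`, `I₂ = {w ∈ C ∪ I : r ∉ w, insert r w ∈ I ∪ co C}`,
`J₂ = {w ∈ J ∪ co C : r ∉ w, insert r w ∈ C ∪ J}` (written as `filter`s) — with `I₂, J₂` again closed (`edgesAt_twinIn_subset`,
`twinI_closed`, `twinJ_closed`, `edgesAt_closed`).  All families are written out explicitly (no new definitions).
-/

namespace Summit.CriticalPhenomena.PercolationContinuityZ3.Theorems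

namespace GeneratedDonors

open Finset FinsetFamily

variable {α : Type*} [DecidableEq α]

section DeltaMS


/-- Membership in the closure. -/
theorem mem_cl {U : Finset α} {Z : Finset (Finset α)} {s : Finset α} :
    s ∈ (Z ∪ Finset.image (fun z => U \ z) Z) ↔ s ∈ Z ∨ ∃ z ∈ Z, U \ z = s := by
  rw [mem_union, mem_image]

/-- Members are in the closure. -/
theorem mem_cl_of_mem {U : Finset α} {Z : Finset (Finset α)} {s : Finset α} (h : s ∈ Z) : s ∈ (Z ∪ Finset.image (fun z => U \ z) Z) :=
  mem_cl.mpr (Or.inl h)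

/-- Complements of members are in the closure. -/
theorem compl_mem_cl_of_mem {U : Finset α} {Z : Finset (Finset α)} {s : Finset α} (h : s ∈ Z) : U \ s ∈ (Z ∪ Finset.image (fun z => U \ z) Z) :=
  mem_cl.mpr (Or.inr ⟨s, h, rfl⟩)

/-- The closure is closed under `U \ ·` when all members of `Z` lie in `U`. -/
theorem compl_mem_cl {U : Finset α} {Z : Finset (Finset α)} (hZ : ∀ z ∈ Z, z ⊆ U) {s : Finset α} (h : s ∈ (Z ∪ Finset.image (fun z => U \ z) Z)) :
    U \ s ∈ (Z ∪ Finset.image (fun z => U \ z) Z) := by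
  rcases mem_cl.mp h with hs | ⟨z, hz, rfl⟩
  · exact compl_mem_cl_of_mem hs
  · rw [Finset.sdiff_sdiff_eq_self (hZ z hz)]; exact mem_cl_of_mem hz

/-- `Z ⊆ cl U Z`. -/
theorem subset_cl (U : Finset α) (Z : Finset (Finset α)) : Z ⊆ (Z ∪ Finset.image (fun z => U \ z) Z) := fun _ h => mem_cl_of_mem h



/-- Membership in the input family. -/
theorem mem_twinIn {U : Finset α} {C I J : Finset (Finset α)} {s : Finset α} :
    s ∈ ((C ∪ Finset.image (fun c => U \ c) C) ∪ (I ∪ J)) ↔ (s ∈ C ∨ ∃ c ∈ C, U \ c = s) ∨ (s ∈ I ∨ s ∈ J) := by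
  rw [mem_union, mem_union, mem_union, mem_image]

/-- A meet of a member of `C ∪ J` with a member of `co C ∪ I` is an output. -/
theorem inter_mem_twinOut {U : Finset α} {C I J : Finset (Finset α)} {p q : Finset α}
    (hp : p ∈ C ∨ p ∈ J) (hq : (∃ c ∈ C, U \ c = q) ∨ q ∈ I) : p ∩ q ∈ (((C ∪ J) ⊼ (Finset.image (fun c => U \ c) C ∪ I)) ∪ (I ∪ J)) := by
  rw [mem_union]; left
  rw [mem_infs]
  refine ⟨p, mem_union.mpr hp, q, ?_, rfl⟩
  rw [mem_union, mem_image]; exact hq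

/-- Members of `I` are outputs. -/
theorem mem_twinOut_of_mem_I {U : Finset α} {C I J : Finset (Finset α)} {s : Finset α} (h : s ∈ I) :
    s ∈ (((C ∪ J) ⊼ (Finset.image (fun c => U \ c) C ∪ I)) ∪ (I ∪ J)) := by
  rw [mem_union, mem_union]; exact Or.inr (Or.inl h)

/-- Members of `J` are outputs. -/
theorem mem_twinOut_of_mem_J {U : Finset α} {C I J : Finset (Finset α)} {s : Finset α} (h : s ∈ J) :
    s ∈ (((C ∪ J) ⊼ (Finset.image (fun c => U \ c) C ∪ I)) ∪ (I ∪ J)) := by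
  rw [mem_union, mem_union]; exact Or.inr (Or.inr h)

/-- Membership in the output family. -/
theorem mem_twinOut {U : Finset α} {C I J : Finset (Finset α)} {s : Finset α} :
    s ∈ (((C ∪ J) ⊼ (Finset.image (fun c => U \ c) C ∪ I)) ∪ (I ∪ J)) ↔
      (∃ p, (p ∈ C ∨ p ∈ J) ∧ ∃ q, ((∃ c ∈ C, U \ c = q) ∨ q ∈ I) ∧ p ∩ q = s) ∨ (s ∈ I ∨ s ∈ J) := by
  rw [mem_union, mem_union, mem_infs]
  constructor
  · rintro (⟨p, hp, q, hq, rfl⟩ | h)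
    · left
      rw [mem_union] at hp
      rw [mem_union, mem_image] at hq
      exact ⟨p, hp, q, hq, rfl⟩
    · exact Or.inr h
  · rintro (⟨p, hp, q, hq, rfl⟩ | h)
    · left
      exact ⟨p, mem_union.mpr hp, q, by rw [mem_union, mem_image]; exact hq, rfl⟩
    · exact Or.inr h

/-- Members of the output lie in `U`. -/
theorem twinOut_subset {U : Finset α} {C I J : Finset (Finset α)}
    (hC : ∀ c ∈ C, c ⊆ U) (hI : ∀ i ∈ I, i ⊆ U) (hJ : ∀ j ∈ J, j ⊆ U) :
    ∀ s ∈ (((C ∪ J) ⊼ (Finset.image (fun c => U \ c) C ∪ I)) ∪ (I ∪ J)), s ⊆ U := by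
  intro s hs
  rcases mem_twinOut.mp hs with ⟨p, hp, q, _, rfl⟩ | (h | h)
  · exact inter_subset_left.trans (hp.elim (hC p) (hJ p))
  · exact hI s h
  · exact hJ s h

/-! ### Elementary identities for a ground set `insert r U'` with `r ∉ U'` -/

section Ground

variable {U' : Finset α} {r : α}

/-- `U \ insert r w = U' \ w`. -/
theorem insertGround_sdiff_insert (hr : r ∉ U') (w : Finset α) : insert r U' \ insert r w = U' \ w := by
  ext a
  simp only [mem_sdiff, mem_insert]
  constructor
  · rintro ⟨h1, h2⟩
    rcases h1 with rfl | h1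
    · exact absurd (Or.inl rfl) h2
    · exact ⟨h1, fun h => h2 (Or.inr h)⟩
  · rintro ⟨h1, h2⟩
    refine ⟨Or.inr h1, ?_⟩
    rintro (rfl | h)
    · exact hr h1
    · exact h2 h

/-- `(U \ c).erase r = U' \ c.erase r`. -/
theorem erase_insertGround_sdiff (hr : r ∉ U') (c : Finset α) : (insert r U' \ c).erase r = U' \ c.erase r := by
  ext a
  simp only [mem_erase, mem_sdiff, mem_insert]
  constructor
  · rintro ⟨hne, h1, h2⟩
    exact ⟨h1.resolve_left hne, fun h => h2 h.2⟩
  · rintro ⟨h1, h2⟩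
    have hne : a ≠ r := fun h => hr (h ▸ h1)
    exact ⟨hne, Or.inr h1, fun h => h2 ⟨hne, h⟩⟩

/-- `erase r` distributes over `∩`. -/
theorem erase_inter_distrib' (r : α) (p q : Finset α) : (p ∩ q).erase r = p.erase r ∩ q.erase r := by
  ext a; simp only [mem_erase, mem_inter]; tauto

/-- For `r ∉ p`: `p ∩ insert r q = p ∩ q`. -/
theorem inter_insert_of_notMem' {p : Finset α} (q : Finset α) (hp : r ∉ p) : p ∩ insert r q = p ∩ q := by
  ext a; simp only [mem_inter, mem_insert]
  constructor
  · rintro ⟨h1, rfl | h2⟩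
    · exact absurd h1 hp
    · exact ⟨h1, h2⟩
  · rintro ⟨h1, h2⟩; exact ⟨h1, Or.inr h2⟩

/-- For `r ∉ q`: `insert r p ∩ q = p ∩ q`. -/
theorem insert_inter_of_notMem' (p : Finset α) {q : Finset α} (hq : r ∉ q) : insert r p ∩ q = p ∩ q := by
  rw [inter_comm, inter_insert_of_notMem' p hq, inter_comm]

/-- `insert r p ∩ insert r q = insert r (p ∩ q)`. -/
theorem insert_inter_insert (r : α) (p q : Finset α) : insert r p ∩ insert r q = insert r (p ∩ q) := by
  ext a; simp only [mem_inter, mem_insert]; tauto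

/-- An `r`-free subset of `insert r U'` lies in `U'`. -/
theorem subset_of_subset_insert_of_notMem {w : Finset α} (hw : w ⊆ insert r U') (hrw : r ∉ w) : w ⊆ U' := by
  intro a ha
  rcases mem_insert.mp (hw ha) with rfl | h
  · exact absurd ha hrw
  · exact h

end Ground

/-! ### The derived ("twin") configuration -/




/-- Membership in `C₂`. -/
theorem mem_twinC {r : α} {C I J : Finset (Finset α)} {w : Finset α} :
    w ∈ (Finset.filter (fun w => r ∉ w ∧ insert r w ∈ C ∪ J) (C ∪ I)) ↔ (w ∈ C ∨ w ∈ I) ∧ r ∉ w ∧ (insert r w ∈ C ∨ insert r w ∈ J) := by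
  rw [mem_filter, mem_union, mem_union]

/-- Membership in `I₂`. -/
theorem mem_twinI {U : Finset α} {r : α} {C I : Finset (Finset α)} {w : Finset α} :
    w ∈ (Finset.filter (fun w => r ∉ w ∧ insert r w ∈ I ∪ Finset.image (fun c => U \ c) C) (C ∪ I)) ↔ (w ∈ C ∨ w ∈ I) ∧ r ∉ w ∧ (insert r w ∈ I ∨ ∃ c ∈ C, U \ c = insert r w) := by
  rw [mem_filter, mem_union, mem_union, mem_image]

/-- Membership in `J₂`. -/
theorem mem_twinJ {U : Finset α} {r : α} {C J : Finset (Finset α)} {w : Finset α} :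
    w ∈ (Finset.filter (fun w => r ∉ w ∧ insert r w ∈ C ∪ J) (J ∪ Finset.image (fun c => U \ c) C)) ↔ (w ∈ J ∨ ∃ c ∈ C, U \ c = w) ∧ r ∉ w ∧ (insert r w ∈ C ∨ insert r w ∈ J) := by
  rw [mem_filter, mem_union, mem_image, mem_union]

section Step

variable {U' : Finset α} {r : α} {C I J : Finset (Finset α)}

/-! #### (a) the projection part -/

/-- The output of the projected families lies in the projection of the output. -/
theorem cl_twinOut_image_subset (hr : r ∉ U')
    (hC : ∀ c ∈ C, c ⊆ insert r U') (hI : ∀ i ∈ I, i ⊆ insert r U') (hJ : ∀ j ∈ J, j ⊆ insert r U') :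
    (((((C.image fun s => s.erase r) ∪ (J.image fun s => s.erase r)) ⊼ (Finset.image (fun c => U' \ c) (C.image fun s => s.erase r) ∪ (I.image fun s => s.erase r)))
          ∪ ((I.image fun s => s.erase r) ∪ (J.image fun s => s.erase r))) ∪ Finset.image (fun z => U' \ z) ((((C.image fun s => s.erase r)
          ∪ (J.image fun s => s.erase r)) ⊼ (Finset.image (fun c => U' \ c) (C.image fun s => s.erase r) ∪ (I.image fun s => s.erase r)))
          ∪ ((I.image fun s => s.erase r) ∪ (J.image fun s => s.erase r)))) ⊆
      (((((C ∪ J) ⊼ (Finset.image (fun c => (insert r U') \ c) C ∪ I)) ∪ (I ∪ J)) ∪ Finset.image (fun z => (insert r U') \ z) (((C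
            ∪ J) ⊼ (Finset.image (fun c => (insert r U') \ c) C ∪ I)) ∪ (I ∪ J)))).image fun s => s.erase r := by
  have hout : ∀ s ∈ (((C ∪ J) ⊼ (Finset.image (fun c => (insert r U') \ c) C ∪ I)) ∪ (I ∪ J)), s ⊆ insert r U' := twinOut_subset hC hI hJ
  have key : ((((C.image fun s => s.erase r) ∪ (J.image fun s => s.erase r)) ⊼ (Finset.image (fun c => U' \ c) (C.image fun s => s.erase r)
        ∪ (I.image fun s => s.erase r))) ∪ ((I.image fun s => s.erase r) ∪ (J.image fun s => s.erase r))) ⊆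
      (((((C ∪ J) ⊼ (Finset.image (fun c => (insert r U') \ c) C ∪ I)) ∪ (I ∪ J)) ∪ Finset.image (fun z => (insert r U') \ z) (((C
            ∪ J) ⊼ (Finset.image (fun c => (insert r U') \ c) C ∪ I)) ∪ (I ∪ J)))).image fun s => s.erase r := by
    intro z hz
    rw [mem_image]
    rcases mem_twinOut.mp hz with ⟨p', hp', q', hq', rfl⟩ | (h | h)
    · obtain ⟨p, hp, rfl⟩ : ∃ p, (p ∈ C ∨ p ∈ J) ∧ p.erase r = p' := by
        rcases hp' with h | h
        · obtain ⟨p, hp, rfl⟩ := mem_image.mp h; exact ⟨p, Or.inl hp, rfl⟩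
        · obtain ⟨p, hp, rfl⟩ := mem_image.mp h; exact ⟨p, Or.inr hp, rfl⟩
      obtain ⟨q, hq, rfl⟩ : ∃ q, ((∃ c ∈ C, insert r U' \ c = q) ∨ q ∈ I) ∧ q.erase r = q' := by
        rcases hq' with ⟨c', hc', hcq⟩ | h
        · obtain ⟨c, hc, rfl⟩ := mem_image.mp hc'
          refine ⟨insert r U' \ c, Or.inl ⟨c, hc, rfl⟩, ?_⟩
          rw [← hcq]; exact erase_insertGround_sdiff hr c
        · obtain ⟨q, hq, rfl⟩ := mem_image.mp h; exact ⟨q, Or.inr hq, rfl⟩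
      exact ⟨p ∩ q, mem_cl_of_mem (inter_mem_twinOut hp hq), erase_inter_distrib' r p q⟩
    · obtain ⟨i, hi, rfl⟩ := mem_image.mp h
      exact ⟨i, mem_cl_of_mem (mem_twinOut_of_mem_I hi), rfl⟩
    · obtain ⟨j, hj, rfl⟩ := mem_image.mp h
      exact ⟨j, mem_cl_of_mem (mem_twinOut_of_mem_J hj), rfl⟩
  intro z hz
  rcases mem_cl.mp hz with h | ⟨o', ho', rfl⟩
  · exact key h
  · obtain ⟨o, ho, rfl⟩ := mem_image.mp (key ho')
    rw [mem_image]
    exact ⟨insert r U' \ o, compl_mem_cl hout ho, erase_insertGround_sdiff hr o⟩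

/-- The projection of the input lies in the input of the projected families. -/
theorem twinIn_image_subset (hr : r ∉ U') :
    (((C ∪ Finset.image (fun c => (insert r U') \ c) C) ∪ (I ∪ J))).image (fun s => s.erase r) ⊆
      (((C.image fun s => s.erase r) ∪ Finset.image (fun c => U' \ c) (C.image fun s => s.erase r)) ∪ ((I.image fun s => s.erase r) ∪ (J.image fun s => s.erase r))) := by
  intro z hz
  obtain ⟨s, hs, rfl⟩ := mem_image.mp hz
  rw [mem_twinIn]
  rcases mem_twinIn.mp hs with (h | ⟨c, hc, rfl⟩) | (h | h)
  · exact Or.inl (Or.inl (mem_image_of_mem _ h))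
  · exact Or.inl (Or.inr ⟨c.erase r, mem_image_of_mem _ hc, (erase_insertGround_sdiff hr c).symm⟩)
  · exact Or.inr (Or.inl (mem_image_of_mem _ h))
  · exact Or.inr (Or.inr (mem_image_of_mem _ h))

/-- The image of a `U`-closed family under `erase r` is `U'`-closed. -/
theorem image_erase_closed (hr : r ∉ U') (hIc : ∀ i ∈ I, insert r U' \ i ∈ I) :
    ∀ i ∈ I.image (fun s => s.erase r), U' \ i ∈ I.image (fun s => s.erase r) := by
  intro i hi
  obtain ⟨s, hs, rfl⟩ := mem_image.mp hi
  rw [mem_image]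
  exact ⟨insert r U' \ s, hIc s hs, erase_insertGround_sdiff hr s⟩

/-- Members of an image under `erase r` of subsets of `insert r U'` lie in `U'`. -/
theorem image_erase_subset (hC : ∀ c ∈ C, c ⊆ insert r U') :
    ∀ c ∈ C.image (fun s => s.erase r), c ⊆ U' := by
  intro c hc
  obtain ⟨s, hs, rfl⟩ := mem_image.mp hc
  intro a ha
  rw [mem_erase] at ha
  rcases mem_insert.mp (hC s hs ha.2) with h | h
  · exact absurd h ha.1
  · exact h

/-! #### (b) the twin part -/

/-- The `r`-twins of the input lie in the input of the derived configuration. -/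
theorem edgesAt_twinIn_subset (hr : r ∉ U')
    (hC : ∀ c ∈ C, c ⊆ insert r U') (hJ : ∀ j ∈ J, j ⊆ insert r U')
    (hIc : ∀ i ∈ I, insert r U' \ i ∈ I) (hJc : ∀ j ∈ J, insert r U' \ j ∈ J) :
    edgesAt (((C ∪ Finset.image (fun c => (insert r U') \ c) C) ∪ (I ∪ J))) r ⊆
      (((Finset.filter (fun w => r ∉ w ∧ insert r w ∈ C ∪ J) (C ∪ I)) ∪ Finset.image (fun c => U' \ c) (Finset.filter (fun w => r ∉ w ∧ insert r w ∈ C ∪ J) (C ∪ I)))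
            ∪ ((Finset.filter (fun w => r ∉ w ∧ insert r w ∈ I ∪ Finset.image (fun c => (insert r U') \ c) C) (C ∪ I)) ∪ (Finset.filter (fun w => r ∉ w ∧ insert r w
            ∈ C ∪ J) (J ∪ Finset.image (fun c => (insert r U') \ c) C)))) := by
  intro w hw
  rw [mem_edgesAt] at hw
  obtain ⟨hw, hrw, hw'⟩ := hw
  rw [mem_twinIn]
  rw [mem_twinIn] at hw hw'
  have hcases : (w ∈ C ∨ w ∈ I) ∨ (w ∈ J ∨ ∃ c ∈ C, insert r U' \ c = w) := by
    rcases hw with (h | h) | (h | h)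
    · exact Or.inl (Or.inl h)
    · exact Or.inr (Or.inr h)
    · exact Or.inl (Or.inr h)
    · exact Or.inr (Or.inl h)
  have hcases' : (insert r w ∈ C ∨ insert r w ∈ J) ∨ (insert r w ∈ I ∨ ∃ c ∈ C, insert r U' \ c = insert r w) := by
    rcases hw' with (h | h) | (h | h)
    · exact Or.inl (Or.inl h)
    · exact Or.inr (Or.inr h)
    · exact Or.inr (Or.inl h)
    · exact Or.inl (Or.inr h)
  rcases hcases with h1 | h1 <;> rcases hcases' with h2 | h2
  · exact Or.inl (Or.inl (mem_twinC.mpr ⟨h1, hrw, h2⟩))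
  · exact Or.inr (Or.inl (mem_twinI.mpr ⟨h1, hrw, h2⟩))
  · exact Or.inr (Or.inr (mem_twinJ.mpr ⟨h1, hrw, h2⟩))
  · -- `w` is the complement in `U'` of the member `U' \ w` of `C₂`
    have hwU : w ⊆ U' := by
      rcases h1 with h1 | ⟨c, _, hcw⟩
      · exact subset_of_subset_insert_of_notMem (hJ w h1) hrw
      · rw [← hcw]; rw [← hcw] at hrw; exact subset_of_subset_insert_of_notMem sdiff_subset hrw
    refine Or.inl (Or.inr ⟨U' \ w, ?_, Finset.sdiff_sdiff_eq_self hwU⟩)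
    rw [mem_twinC]
    refine ⟨?_, fun h => hr (mem_sdiff.mp h).1, ?_⟩
    · rw [← insertGround_sdiff_insert hr w]
      rcases h2 with h2 | ⟨c, hc, hcw⟩
      · exact Or.inr (hIc _ h2)
      · rw [← hcw, Finset.sdiff_sdiff_eq_self (hC c hc)]; exact Or.inl hc
    · rw [← Finset.insert_sdiff_of_notMem U' hrw]
      rcases h1 with h1 | ⟨c, hc, hcw⟩
      · exact Or.inr (hJc _ h1)
      · rw [← hcw, Finset.sdiff_sdiff_eq_self (hC c hc)]; exact Or.inl hc

/-- Members of `C₂` lie in `U'`. -/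
theorem twinC_subset (hC : ∀ c ∈ C, c ⊆ insert r U') (hI : ∀ i ∈ I, i ⊆ insert r U') :
    ∀ w ∈ (Finset.filter (fun w => r ∉ w ∧ insert r w ∈ C ∪ J) (C ∪ I)), w ⊆ U' := by
  intro w hw
  obtain ⟨h1, hrw, _⟩ := mem_twinC.mp hw
  exact subset_of_subset_insert_of_notMem (h1.elim (hC w) (hI w)) hrw

/-- Members of `I₂` lie in `U'`. -/
theorem twinI_subset (hC : ∀ c ∈ C, c ⊆ insert r U') (hI : ∀ i ∈ I, i ⊆ insert r U') :
    ∀ w ∈ (Finset.filter (fun w => r ∉ w ∧ insert r w ∈ I ∪ Finset.image (fun c => (insert r U') \ c) C) (C ∪ I)), w ⊆ U' := by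
  intro w hw
  obtain ⟨h1, hrw, _⟩ := mem_twinI.mp hw
  exact subset_of_subset_insert_of_notMem (h1.elim (hC w) (hI w)) hrw

/-- Members of `J₂` lie in `U'`. -/
theorem twinJ_subset (hJ : ∀ j ∈ J, j ⊆ insert r U') :
    ∀ w ∈ (Finset.filter (fun w => r ∉ w ∧ insert r w ∈ C ∪ J) (J ∪ Finset.image (fun c => (insert r U') \ c) C)), w ⊆ U' := by
  intro w hw
  obtain ⟨h1, hrw, _⟩ := mem_twinJ.mp hw
  rcases h1 with h1 | ⟨c, _, hcw⟩
  · exact subset_of_subset_insert_of_notMem (hJ w h1) hrw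
  · rw [← hcw]; rw [← hcw] at hrw; exact subset_of_subset_insert_of_notMem sdiff_subset hrw

/-- `I₂` is closed under complementation in `U'`. -/
theorem twinI_closed (hr : r ∉ U') (hC : ∀ c ∈ C, c ⊆ insert r U')
    (hIc : ∀ i ∈ I, insert r U' \ i ∈ I) :
    ∀ w ∈ (Finset.filter (fun w => r ∉ w ∧ insert r w ∈ I ∪ Finset.image (fun c => (insert r U') \ c) C) (C ∪ I)), U' \ w ∈ (Finset.filter (fun w => r ∉ w ∧ insert r w
          ∈ I ∪ Finset.image (fun c => (insert r U') \ c) C) (C ∪ I)) := by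
  intro w hw
  obtain ⟨h1, hrw, h2⟩ := mem_twinI.mp hw
  rw [mem_twinI]
  refine ⟨?_, fun h => hr (mem_sdiff.mp h).1, ?_⟩
  · -- U' \ w = U \ insert r w ∈ I ∪ C
    rw [← insertGround_sdiff_insert hr w]
    rcases h2 with h2 | ⟨c, hc, hcw⟩
    · exact Or.inr (hIc _ h2)
    · rw [← hcw, Finset.sdiff_sdiff_eq_self (hC c hc)]; exact Or.inl hc
  · -- insert r (U' \ w) = U \ w ∈ I ∪ co C
    rw [← Finset.insert_sdiff_of_notMem U' hrw]
    rcases h1 with h1 | h1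
    · exact Or.inr ⟨w, h1, rfl⟩
    · exact Or.inl (hIc _ h1)

/-- `J₂` is closed under complementation in `U'`. -/
theorem twinJ_closed (hr : r ∉ U') (hC : ∀ c ∈ C, c ⊆ insert r U')
    (hJc : ∀ j ∈ J, insert r U' \ j ∈ J) :
    ∀ w ∈ (Finset.filter (fun w => r ∉ w ∧ insert r w ∈ C ∪ J) (J ∪ Finset.image (fun c => (insert r U') \ c) C)), U' \ w ∈ (Finset.filter (fun w => r ∉ w ∧ insert r w
          ∈ C ∪ J) (J ∪ Finset.image (fun c => (insert r U') \ c) C)) := by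
  intro w hw
  obtain ⟨h1, hrw, h2⟩ := mem_twinJ.mp hw
  rw [mem_twinJ]
  refine ⟨?_, fun h => hr (mem_sdiff.mp h).1, ?_⟩
  · -- U' \ w = U \ insert r w ∈ J ∪ co C
    rw [← insertGround_sdiff_insert hr w]
    rcases h2 with h2 | h2
    · exact Or.inr ⟨insert r w, h2, rfl⟩
    · exact Or.inl (hJc _ h2)
  · -- insert r (U' \ w) = U \ w ∈ C ∪ J
    rw [← Finset.insert_sdiff_of_notMem U' hrw]
    rcases h1 with h1 | ⟨c, hc, hcw⟩
    · exact Or.inr (hJc _ h1)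
    · rw [← hcw, Finset.sdiff_sdiff_eq_self (hC c hc)]; exact Or.inl hc

/-- The `r`-twins of a `U`-closed family form a `U'`-closed family. -/
theorem edgesAt_closed (hr : r ∉ U') {Z : Finset (Finset α)} (hZc : ∀ z ∈ Z, insert r U' \ z ∈ Z) :
    ∀ w ∈ edgesAt Z r, U' \ w ∈ edgesAt Z r := by
  intro w hw
  obtain ⟨hw, hrw, hw'⟩ := mem_edgesAt.mp hw
  rw [mem_edgesAt]
  refine ⟨?_, fun h => hr (mem_sdiff.mp h).1, ?_⟩
  · rw [← insertGround_sdiff_insert hr w]; exact hZc _ hw'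
  · rw [← Finset.insert_sdiff_of_notMem U' hrw]; exact hZc _ hw

end Step

end DeltaMS

end GeneratedDonors

end Summit.CriticalPhenomena.PercolationContinuityZ3.Theorems
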